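import Mathlib
import Literature.AlgebraicGeometry.Resolution.FormalFibresRegularDerivations

/-!
# `PAlteration.PicoverToRadicialBottom`, line `theta-finite-cofinite-roots`: the regular limit

Helper file of the line lead (stub `stub_cofiniteRegularTwist`): **`L ⊗_k A` is a regular ring
when `L` is exhausted by intermediate fields `K` with `K ⊗_k A` regular** (`A` of finite type
over `k`): a prime `Q` of `L ⊗_k A` is extended from `K ⊗_k A` for `K` large (finitely many
generators), `L ⊗_k A ≅ (K ⊗_k A) ⊗_K L` is flat over `K ⊗_k A`, so `ht Q = ht (Q ∩ (K ⊗ A))`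
(going-down, Matsumura 15.1) and `𝔪_Q` needs no more generators than `𝔪_{Q ∩ (K ⊗ A)}`.
Applied to the `p`-th root fields `k(θ S) = ⋃_F k(θ F)`.
-/

noncomputable section

-- single-problem summit: the doubled namespace component `ResolutionOfSingularities` is forced
set_option linter.dupNamespace false

open Polynomial TensorProduct Literature.AlgebraicGeometry.Resolution

namespace Summit.ResolutionOfSingularities.ResolutionOfSingularities.Theorems

variable {p : ℕ} [Fact p.Prime] {k : Type} [Field k] [CharP k p]

variable {Ω : Type} [Field Ω] [Algebra k Ω] (θ : k → Ω) (hθ : ∀ a : k, θ a ^ p = algebraMap k Ω a)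

/-! ## The limit: `L ⊗_k A` is regular when `L` is exhausted by `K` with `K ⊗_k A` regular -/

section Limit

open IsLocalRing

/-- **Regularity along a going-down extension with extended prime**: for `R → S` with going-down
(`R`, `S` Noetherian), a prime `Q` of `S` which is extended from `P := Q ∩ R` (`Q = P S`) with
`R_P` regular, the local ring `S_Q` is regular: `ht Q = ht P` (Matsumura Thm. 15.1, Mathlib
`Ideal.height_eq_height_add_of_liesOver_of_hasGoingDown`) and `𝔪_Q = 𝔪_P S_Q` needs at most
`dim R_P` generators. [cite: Matsumura1987, Thm. 15.1 and Thm. 23.7] -/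
theorem isRegularLocalRing_localization_of_hasGoingDown_of_map_comap_eq {R S : Type}
    [CommRing R] [CommRing S] [Algebra R S] [IsNoetherianRing R] [IsNoetherianRing S]
    [Algebra.HasGoingDown R S] (Q : Ideal S) [Q.IsPrime]
    [IsRegularLocalRing (Localization.AtPrime (Q.comap (algebraMap R S)))]
    (hQ : (Q.comap (algebraMap R S)).map (algebraMap R S) = Q) :
    IsRegularLocalRing (Localization.AtPrime Q) := by
  set P := Q.comap (algebraMap R S) with hP
  haveI : Q.LiesOver P := ⟨rfl⟩
  let A := Localization.AtPrime P
  let B := Localization.AtPrime Q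
  -- `ht Q = ht P`, so `dim B = dim A`
  have hPQ : Q.height = P.height := by
    have h' := Ideal.height_eq_height_add_of_liesOver_of_hasGoingDown P Q
    rw [hQ, Ideal.map_quotient_self, Ideal.height_bot, add_zero] at h'
    exact h'
  have hdim : ringKrullDim B = ringKrullDim A := by
    rw [IsLocalization.AtPrime.ringKrullDim_eq_height Q B,
      IsLocalization.AtPrime.ringKrullDim_eq_height P A, hPQ]
  -- the local homomorphism `A → B` and `𝔪_B = 𝔪_A B`
  let φ : A →+* B := Localization.localRingHom P Q (algebraMap R S) hP
  have hφ : φ.comp (algebraMap R A) = (algebraMap S B).comp (algebraMap R S) := by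
    ext x
    exact Localization.localRingHom_to_map P Q (algebraMap R S) hP x
  have hmax : (maximalIdeal A).map φ = maximalIdeal B := by
    rw [← Localization.AtPrime.map_eq_maximalIdeal, ← Localization.AtPrime.map_eq_maximalIdeal,
      Ideal.map_map, hφ, ← Ideal.map_map, hQ]
  -- `𝔪_B` is generated by `emb dim A = dim A = dim B` elements
  apply IsRegularLocalRing.of_spanFinrank_maximalIdeal_le
  rw [hdim, ← IsRegularLocalRing.spanFinrank_maximalIdeal (R := A), ← hmax]
  obtain ⟨s, hs, hspan⟩ := Submodule.FG.exists_span_finset_card_eq_spanFinrank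
    (maximalIdeal A).fg_of_isNoetherianRing
  have hs' : (maximalIdeal A).map φ = Ideal.span (φ '' (s : Set A)) := by
    rw [← hspan]
    exact Ideal.map_span φ (s : Set A)
  rw [hs']
  refine WithBot.coe_le_coe.mpr (Nat.cast_le.mpr ?_)
  refine (Submodule.spanFinrank_span_le_ncard_of_finite ((Finset.finite_toSet s).image _)).trans
    ?_
  rw [← hs]
  exact (Set.ncard_image_le (Finset.finite_toSet s)).trans (by rw [Set.ncard_coe_finset])

omit [Fact p.Prime] [CharP k p] in
/-- **The flat model.** For fields `k ⊆ F ⊆ L` and a `k`-algebra `A` with `F ⊗_k A` regular, a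
prime `Q` of `L ⊗_k A` extended from `F ⊗_k A` (`Q = (Q ∩ (F ⊗ A)) (L ⊗ A)`) has regular local
ring: `L ⊗_k A ≅ (F ⊗_k A) ⊗_F L` is flat over `F ⊗_k A` (going-down), and
`isRegularLocalRing_localization_of_hasGoingDown_of_map_comap_eq` applies. [folklore] -/
theorem isRegularLocalRing_localization_tensor_of_extended {F L : Type} [Field F] [Field L]
    [Algebra k F] [Algebra k L] [Algebra F L] [IsScalarTower k F L] (A : Type) [CommRing A]
    [Algebra k A] [IsNoetherianRing (L ⊗[k] A)] [IsRegularRing (F ⊗[k] A)]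
    (Q : Ideal (L ⊗[k] A)) [Q.IsPrime]
    (hQ : Q = (Q.comap (Algebra.TensorProduct.map (IsScalarTower.toAlgHom k F L)
      (AlgHom.id k A)).toRingHom).map (Algebra.TensorProduct.map (IsScalarTower.toAlgHom k F L)
      (AlgHom.id k A)).toRingHom) :
    IsRegularLocalRing (Localization.AtPrime Q) := by
  set ι : F ⊗[k] A →ₐ[k] L ⊗[k] A :=
    Algebra.TensorProduct.map (IsScalarTower.toAlgHom k F L) (AlgHom.id k A) with hι
  let BK : Type := F ⊗[k] A
  let B'' : Type := BK ⊗[F] L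
  let e : B'' ≃+* L ⊗[k] A :=
    (Algebra.TensorProduct.comm F BK L).toRingEquiv.trans
      (Algebra.TensorProduct.cancelBaseChange k F L L A).toRingEquiv
  have he : ∀ y : BK, e (y ⊗ₜ[F] (1 : L)) = ι y := by
    intro y
    induction y using TensorProduct.induction_on with
    | zero => rw [TensorProduct.zero_tmul, map_zero, map_zero]
    | tmul ℓ a =>
      change Algebra.TensorProduct.cancelBaseChange k F L L A
        (Algebra.TensorProduct.comm F BK L ((ℓ ⊗ₜ[k] a) ⊗ₜ[F] (1 : L))) = _
      rw [Algebra.TensorProduct.comm_tmul, Algebra.TensorProduct.cancelBaseChange_tmul]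
      change (ℓ • (1 : L)) ⊗ₜ[k] a = (algebraMap F L ℓ) ⊗ₜ[k] a
      rw [Algebra.smul_def, mul_one]
    | add x y hx hy => rw [TensorProduct.add_tmul, map_add, hx, hy, map_add]
  have he' : ∀ y : BK, e (algebraMap BK B'' y) = ι y := fun y => by
    have : algebraMap BK B'' y = y ⊗ₜ[F] (1 : L) := rfl
    rw [this]
    exact he y
  -- `B''` is Noetherian (via `e`) and flat over `B_K` (going-down)
  haveI : IsNoetherianRing B'' := isNoetherianRing_of_ringEquiv (L ⊗[k] A) e.symm
  haveI : Algebra.HasGoingDown BK B'' := inferInstance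
  -- `Q'' := e⁻¹ Q` is extended from `P := Q'' ∩ B_K = Q ∩ B_K`
  let Q'' : Ideal B'' := Q.comap e
  haveI hQ''prime : Q''.IsPrime := Ideal.comap_isPrime e Q
  set P : Ideal BK := Q''.comap (algebraMap BK B'') with hPdef
  have hPι : P = Q.comap ι.toRingHom := by
    ext y
    rw [hPdef, Ideal.mem_comap, Ideal.mem_comap, Ideal.mem_comap, he']
    rfl
  have hQ''eq : P.map (algebraMap BK B'') = Q'' := by
    refine le_antisymm (Ideal.map_le_iff_le_comap.mpr le_rfl) ?_
    intro x hx
    have hx' : e x ∈ P.map ι.toRingHom := by rw [hPι, ← hQ]; exact hx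
    have hmap : P.map ι.toRingHom =
        (P.map (algebraMap BK B'')).map (e : B'' →+* L ⊗[k] A) := by
      rw [Ideal.map_map]
      congr 1
      exact RingHom.ext fun y => (he' y).symm
    rw [hmap] at hx'
    obtain ⟨y, hy, hyx⟩ := (Ideal.mem_map_iff_of_surjective (e : B'' →+* L ⊗[k] A)
      e.surjective).mp hx'
    have hyx' : y = x := e.injective hyx
    rwa [← hyx']
  haveI : IsRegularLocalRing (Localization.AtPrime (Q''.comap (algebraMap BK B''))) :=
    IsRegularRing.isRegularLocalRing_localization P
  have hreg'' : IsRegularLocalRing (Localization.AtPrime Q'') :=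
    isRegularLocalRing_localization_of_hasGoingDown_of_map_comap_eq Q'' hQ''eq
  haveI := hreg''
  exact IsRegularLocalRing.of_ringEquiv (R := Localization.AtPrime Q'')
    (IsLocalization.ringEquivOfRingEquiv (Localization.AtPrime (Q.comap e)) (Localization.AtPrime Q)
      e (e.map_primeCompl_comap_eq Q))

omit [Fact p.Prime] [CharP k p] in
/-- **`L ⊗_k A` is regular when every finite subset of `L` lies in an intermediate field `K` with
`K ⊗_k A` regular** (`A` of finite type over `k`). For a prime `Q` of `B := L ⊗_k A`, its
finitely many generators come from `B_K := K ⊗_k A` for one such `K`, so `Q = (Q ∩ B_K) B` and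
the flat model `isRegularLocalRing_localization_tensor_of_extended` applies. [folklore] -/
theorem isRegularRing_tensor_of_exhaustion {L : Type} [Field L] [Algebra k L] (A : Type)
    [CommRing A] [Algebra k A] [Algebra.FiniteType k A]
    (h : ∀ s : Finset L, ∃ K : IntermediateField k L, (↑s : Set L) ⊆ K ∧ IsRegularRing (K ⊗[k] A)) :
    IsRegularRing (L ⊗[k] A) := by
  classical
  haveI : IsNoetherianRing (L ⊗[k] A) := Algebra.FiniteType.isNoetherianRing L (L ⊗[k] A)
  let ι : ∀ K : IntermediateField k L, (K ⊗[k] A →ₐ[k] L ⊗[k] A) := fun K =>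
    Algebra.TensorProduct.map (IsScalarTower.toAlgHom k K L) (AlgHom.id k A)
  -- every element of `B` comes from `B_K` whenever `K` contains a suitable finite set
  have helem : ∀ x : L ⊗[k] A, ∃ s : Finset L, ∀ K : IntermediateField k L, (↑s : Set L) ⊆ K →
      x ∈ Set.range (ι K) := by
    intro x
    induction x using TensorProduct.induction_on with
    | zero => exact ⟨∅, fun K _ => ⟨0, map_zero _⟩⟩
    | tmul ℓ a =>
      refine ⟨{ℓ}, fun K hK => ⟨⟨ℓ, hK (by simp)⟩ ⊗ₜ[k] a, ?_⟩⟩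
      rfl
    | add x y hx hy =>
      obtain ⟨s₁, h₁⟩ := hx
      obtain ⟨s₂, h₂⟩ := hy
      refine ⟨s₁ ∪ s₂, fun K hK => ?_⟩
      rw [Finset.coe_union] at hK
      obtain ⟨x', rfl⟩ := h₁ K (Set.subset_union_left.trans hK)
      obtain ⟨y', rfl⟩ := h₂ K (Set.subset_union_right.trans hK)
      exact ⟨x' + y', map_add _ _ _⟩
  have hcommon : ∀ t : Finset (L ⊗[k] A), ∃ s : Finset L, ∀ K : IntermediateField k L,
      (↑s : Set L) ⊆ K → ∀ q ∈ t, q ∈ Set.range (ι K) := by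
    intro t
    induction t using Finset.induction_on with
    | empty => exact ⟨∅, fun K _ q hq => absurd hq (Finset.notMem_empty q)⟩
    | insert q t _ ih =>
      obtain ⟨s₁, h₁⟩ := ih
      obtain ⟨s₂, h₂⟩ := helem q
      refine ⟨s₁ ∪ s₂, fun K hK x hx => ?_⟩
      rw [Finset.coe_union] at hK
      rcases Finset.mem_insert.mp hx with rfl | hx
      · exact h₂ K (Set.subset_union_right.trans hK)
      · exact h₁ K (Set.subset_union_left.trans hK) x hx
  -- regularity at a prime `Q`
  refine isRegularRing_iff.mpr fun Q hQ => ?_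
  haveI := hQ
  obtain ⟨t, ht⟩ := (inferInstance : IsNoetherianRing (L ⊗[k] A)).noetherian Q
  obtain ⟨s, hs⟩ := hcommon t
  obtain ⟨K, hsK, hregK⟩ := h s
  haveI := hregK
  have hgen : ∀ q ∈ t, q ∈ Set.range (ι K) := hs K hsK
  refine isRegularLocalRing_localization_tensor_of_extended (F := K) A Q (le_antisymm ?_ ?_)
  · rw [← ht, Ideal.span_le]
    intro q hq
    obtain ⟨y, rfl⟩ := hgen q hq
    exact Ideal.mem_map_of_mem _ (Ideal.mem_comap.mpr (Ideal.subset_span hq))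
  · exact Ideal.map_comap_le

include hθ in
omit [Fact p.Prime] [CharP k p] in
/-- `θ` is injective (`θ a ^ p = a`). [folklore] -/
theorem root_injective : Function.Injective θ := fun a b h =>
  (algebraMap k Ω).injective (by rw [← hθ a, ← hθ b, h])

include hθ in
omit [Fact p.Prime] [CharP k p] in
/-- **`k(θ S) ⊗_k A` is regular when all `k(θ F) ⊗_k A`, `F ⊆ S` finite, are** (for `A` of
finite type over `k`): every finite subset of `k(θ S)` lies in some `k(θ F)`
(`isRegularRing_tensor_of_exhaustion`). [folklore] -/
theorem isRegularRing_adjoin_roots_tensor_of_finite (S : Set k) (A : Type) [CommRing A]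
    [Algebra k A] [Algebra.FiniteType k A]
    (hfin : ∀ F : Finset k, (↑F : Set k) ⊆ S →
      IsRegularRing (IntermediateField.adjoin k (θ '' (↑F : Set k)) ⊗[k] A)) :
    IsRegularRing (IntermediateField.adjoin k (θ '' S) ⊗[k] A) := by
  classical
  set LS := IntermediateField.adjoin k (θ '' S) with hLS
  -- the roots inside `LS`
  let θ' : k → LS := fun a => if ha : θ a ∈ LS then ⟨θ a, ha⟩ else 0
  have hθ' : ∀ a ∈ S, (θ' a : Ω) = θ a := fun a ha => by
    have : θ a ∈ LS := IntermediateField.subset_adjoin k _ ⟨a, ha, rfl⟩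
    simp only [θ', dif_pos this]
  refine isRegularRing_tensor_of_exhaustion A fun s => ?_
  -- a finite `F ⊆ S` with `s ⊆ k(θ F)`
  have hx : ∀ x : LS, ∃ F : Finset k, (↑F : Set k) ⊆ S ∧
      (x : Ω) ∈ IntermediateField.adjoin k (θ '' (↑F : Set k)) := by
    intro x
    obtain ⟨T, hTS, hxT⟩ := IntermediateField.exists_finset_of_mem_adjoin x.2
    let F : Finset k := T.preimage θ (root_injective θ hθ).injOn
    have hF : (↑F : Set k) ⊆ S := by
      intro a ha
      rw [Finset.coe_preimage] at ha
      obtain ⟨a', ha', haa'⟩ := hTS ha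
      rwa [← root_injective θ hθ haa']
    have hTF : (↑T : Set Ω) ⊆ θ '' (↑F : Set k) := by
      intro t ht
      obtain ⟨a, _, rfl⟩ := hTS ht
      exact ⟨a, by rw [Finset.coe_preimage]; exact ht, rfl⟩
    exact ⟨F, hF, IntermediateField.adjoin.mono k _ _ hTF hxT⟩
  choose Fx hFxS hFx using hx
  let F : Finset k := s.biUnion Fx
  have hFS : (↑F : Set k) ⊆ S := by
    intro a ha
    obtain ⟨x, -, hax⟩ := Finset.mem_biUnion.mp ha
    exact hFxS x hax
  -- `K := k(θ' F) ⊆ LS`, isomorphic to `k(θ F) ⊆ Ω`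
  let K : IntermediateField k LS := IntermediateField.adjoin k (θ' '' (↑F : Set k))
  have hKmap : K.map LS.val = IntermediateField.adjoin k (θ '' (↑F : Set k)) := by
    rw [IntermediateField.adjoin_map, ← Set.image_comp]
    congr 1
    refine Set.image_congr fun a ha => ?_
    exact hθ' a (hFS ha)
  refine ⟨K, fun x hx => ?_, ?_⟩
  · -- `x ∈ K` since `x ∈ k(θ Fx) ⊆ k(θ F)` in `Ω`
    have hxF : (x : Ω) ∈ IntermediateField.adjoin k (θ '' (↑F : Set k)) :=
      IntermediateField.adjoin.mono k _ _
        (Set.image_mono (Finset.coe_subset.mpr (Finset.subset_biUnion_of_mem Fx hx))) (hFx x)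
    rw [← hKmap] at hxF
    obtain ⟨y, hy, hyx⟩ := K.mem_map.mp hxF
    have : y = x := Subtype.ext hyx
    rwa [← this]
  · haveI := hfin F hFS
    exact isRegularRing_tensor_of_algEquiv k
      (((K.equivMap LS.val).trans (IntermediateField.equivOfEq hKmap)).symm) A

end Limit

/-- **Registered form** of `isRegularRing_tensor_of_exhaustion` (all binders explicit).
[folklore] -/
theorem regularLimit_tensor_of_exhaustion : ∀ (k : Type) [Field k] (L : Type) [Field L]
    [Algebra k L] (A : Type) [CommRing A] [Algebra k A] [Algebra.FiniteType k A],
    (∀ s : Finset L, ∃ K : IntermediateField k L, (↑s : Set L) ⊆ K ∧ IsRegularRing (K ⊗[k] A)) →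
    IsRegularRing (L ⊗[k] A) :=
  fun _ _ _ _ _ A _ _ _ h => isRegularRing_tensor_of_exhaustion A h

end Summit.ResolutionOfSingularities.ResolutionOfSingularities.Theorems

end
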